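import Literature.ModelTheory.Quasiminimal.CountableModels
import HarnessLib

/-!
# Splitting of types in quasiminimal pregeometry structures (BHHKK 2014 §4)

M. Bays, B. Hart, T. Hyttinen, M. Kesälä, J. Kirby, *Quasiminimal structures and excellence*,
Bull. London Math. Soc. 46 (2014) 155–163, §4 ("Splitting of types") and §5 ("Isolation of
types") prove, for a model `𝔐` of a quasiminimal class and a countable closed submodel `M ◁ 𝔐`:

* **Proposition 4.2.** For each finite tuple `ā ∈ 𝔐` there is a finite `A ⊆ M` such that
  `tp(ā/M)` does not split over `A` (Def. 4.1: `tp(ā/B)` *splits over* `A ⊆ B` if there are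
  finite tuples `c̄, d̄ ∈ B` with `tp(c̄/A) = tp(d̄/A)` but `tp(c̄/A ∪ ā) ≠ tp(d̄/A ∪ ā)`).
* (**Proposition 5.2**, s-isolation of types — Def. 5.1 — is NOT in this file; it follows in
  `Isolation.lean`.)

The proofs ("Replacing `𝔐` with `cl(Mā)`, we may assume `𝔐` to be countable") take place in a
countable weakly quasiminimal pregeometry structure, which is the setting of this file: `M` is
our countable structure (BHHKK's `𝔐`) and BHHKK's `M` is a closed subset `C ⊆ M`. Types over a
set `P` are quantifier-free types, `L.EqQFTypeOver P id x̄ ȳ` ("`tp(x̄/P) = tp(ȳ/P)`"); by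
`CountableModels.lean` (Kirby 2010 Prop. 2.3 = BHHKK Lemma 3.1) these are automorphism orbits.

## Contents

* `NotSplitOver L C a A` — `tp(ā/C)` does not split over `A` (Def. 4.1).
* `IsWeaklyQuasiminimalPregeometryStructure.exists_notSplitOver` — Prop. 4.2, by BHHKK's binary
  tree of automorphisms: if `tp(ā/C)` split over every finite subset of `C` one constructs
  `2^ℵ₀` automorphisms `π_μ` with pairwise distinct `π_μ(ā)`, contradicting countability.

## References

* M. Bays, B. Hart, T. Hyttinen, M. Kesälä, J. Kirby, *Quasiminimal structures and excellence*,
  Bull. London Math. Soc. 46 (2014) 155–163, arXiv:1210.2008: Def. 4.1, Prop. 4.2, Def. 5.1,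
  Prop. 5.2, Cor. 5.3.
-/

noncomputable section

open Set FirstOrder FirstOrder.Language

universe u v w

namespace Literature.ModelTheory.Quasiminimal

variable {L : Language.{u, v}} {M : Type w} [L.Structure M] {cl : Set M → Set M}

/-! ### Types over a set: the equivalence relation `EqQFTypeOver P id` -/

section TypesOver

variable {P : Set M} {n : ℕ}

/-- `tp(x̄/P) = tp(x̄/P)`. [folklore] -/
theorem eqQFTypeOver_id_refl (P : Set M) (x : Fin n → M) : L.EqQFTypeOver P id x x :=
  fun _ _ _ => EqQFType.refl _

/-- Symmetry of `tp(x̄/P) = tp(ȳ/P)`. [folklore] -/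
theorem eqQFTypeOver_id_symm {x y : Fin n → M} (h : L.EqQFTypeOver P id x y) :
    L.EqQFTypeOver P id y x :=
  fun _ σ hσ => (h σ hσ).symm

/-- Transitivity of `tp(·/P)` equality. [folklore] -/
theorem eqQFTypeOver_id_trans {x y z : Fin n → M} (h₁ : L.EqQFTypeOver P id x y)
    (h₂ : L.EqQFTypeOver P id y z) : L.EqQFTypeOver P id x z :=
  fun _ σ hσ => (h₁ σ hσ).trans (h₂ σ hσ)

/-- Restriction of the parameter set. [folklore] -/
theorem eqQFTypeOver_id_mono {P P' : Set M} (hP : P' ⊆ P) {x y : Fin n → M}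
    (h : L.EqQFTypeOver P id x y) : L.EqQFTypeOver P' id x y :=
  fun _ σ hσ => h σ fun i => hP (hσ i)

/-- **Automorphisms witness types**: if `θ` is a partial embedding on `univ` fixing `P`
pointwise then `tp(x̄/P) = tp(θ x̄/P)`. [folklore] -/
theorem eqQFTypeOver_id_of_isQFEmbOn {θ : M → M} (hθ : IsQFEmbOn L θ univ)
    (hP : ∀ p ∈ P, θ p = p) (x : Fin n → M) : L.EqQFTypeOver P id x (θ ∘ x) := by
  intro m σ hσ
  have := hθ (Fin.append σ x) fun _ => mem_univ _
  have e : θ ∘ Fin.append σ x = Fin.append (id ∘ σ) (θ ∘ x) := by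
    funext i
    refine Fin.addCases (fun j => ?_) (fun j => ?_) i
    · simpa using hP _ (hσ j)
    · simp
  rwa [e] at this

/-- **Transport of types along automorphisms**: `tp(x̄/P) = tp(ȳ/P)` implies
`tp(θ x̄/θ[P]) = tp(θ ȳ/θ[P])` for `θ` a partial embedding on `univ`. [folklore] -/
theorem _root_.FirstOrder.Language.EqQFTypeOver.image_of_isQFEmbOn {θ : M → M}
    (hθ : IsQFEmbOn L θ univ) {x y : Fin n → M}
    (h : L.EqQFTypeOver P id x y) : L.EqQFTypeOver (θ '' P) id (θ ∘ x) (θ ∘ y) := by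
  intro m σ' hσ'
  choose σ hσP hσ using hσ'
  have e1 : (σ' : Fin m → M) = θ ∘ σ := funext fun i => (hσ i).symm
  have hx := hθ (Fin.append σ x) fun _ => mem_univ _
  have hy := hθ (Fin.append σ y) fun _ => mem_univ _
  have ex : θ ∘ Fin.append σ x = Fin.append σ' (θ ∘ x) := by
    funext i
    refine Fin.addCases (fun j => ?_) (fun j => ?_) i
    · simpa using hσ j
    · simp
  have ey : θ ∘ Fin.append σ y = Fin.append σ' (θ ∘ y) := by
    funext i
    refine Fin.addCases (fun j => ?_) (fun j => ?_) i
    · simpa using hσ j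
    · simp
  rw [ex] at hx
  rw [ey] at hy
  have key := h σ hσP
  simp only [Function.id_comp] at key ⊢
  exact (hx.symm.trans key).trans hy

/-- Types over a set only see finitely many parameters at a time: `tp(x̄/P) = tp(ȳ/P)` iff the
same holds over every finite subset of `P`. [folklore] -/
theorem eqQFTypeOver_id_iff_finite {x y : Fin n → M} :
    L.EqQFTypeOver P id x y ↔ ∀ P₀ ⊆ P, P₀.Finite → L.EqQFTypeOver P₀ id x y := by
  refine ⟨fun h P₀ hP₀ _ => eqQFTypeOver_id_mono hP₀ h, fun h m σ hσ => ?_⟩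
  exact h (range σ) (range_subset_iff.2 hσ) (finite_range σ) σ fun i => mem_range_self i

end TypesOver

/-! ### Automorphisms over finite sets -/

omit [L.Structure M] in
/-- An automorphism preserving `C` setwise has inverse preserving `C`. [folklore] -/
theorem _root_.Equiv.symm_image_eq_of_image_eq {C : Set M} {σ : M ≃ M} (h : σ '' C = C) :
    σ.symm '' C = C :=
  calc σ.symm '' C = σ.symm '' (σ '' C) := by rw [h]
    _ = C := σ.symm_image_image C

namespace IsWeaklyQuasiminimalPregeometryStructure

/-- **Types over a finite set are automorphism orbits, inside a closed set** (BHHKK 2014,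
Lemma 3.1 with `H = ∅` applied to the tuples `(p̄, x̄)`, `(p̄, ȳ)`): if `P ⊆ C` is finite, `C`
closed, `x̄, ȳ ⊆ C` and `tp(x̄/P) = tp(ȳ/P)`, there is an automorphism of `M` fixing `P`
pointwise, preserving `C` setwise, with `x̄ ↦ ȳ`. [cite: BHHKK2014, Lemma 3.1] -/
theorem exists_equiv_of_eqQFTypeOver_finite [Countable M]
    (hW : IsWeaklyQuasiminimalPregeometryStructure L M cl) {C : Set M} (hC : cl C = C)
    {P : Set M} (hPfin : P.Finite) (hPC : P ⊆ C) {n : ℕ} {x y : Fin n → M} (hx : ∀ i, x i ∈ C)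
    (hy : ∀ i, y i ∈ C) (hxy : L.EqQFTypeOver P id x y) :
    ∃ σ : M ≃ M, IsQFEmbOn L σ univ ∧ σ '' C = C ∧ (∀ p ∈ P, σ p = p) ∧ ∀ i, σ (x i) = y i := by
  obtain ⟨k, p, hp⟩ := hPfin.fin_embedding
  have hpP : ∀ j, p j ∈ P := fun j => hp ▸ mem_range_self j
  have key : L.EqQFType (Fin.append (p : Fin k → M) x) (Fin.append (p : Fin k → M) y) := by
    have := hxy p hpP
    simpa only [Function.id_comp] using this
  have h0 : L.EqQFTypeOver (∅ : Set M) id (Fin.append (p : Fin k → M) x)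
      (Fin.append (p : Fin k → M) y) := eqQFTypeOver_empty_iff.2 key
  have hmemx : ∀ i, Fin.append (p : Fin k → M) x i ∈ C := fun i => by
    refine Fin.addCases (fun j => ?_) (fun j => ?_) i
    · simpa using hPC (hpP j)
    · simpa using hx j
  have hmemy : ∀ i, Fin.append (p : Fin k → M) y i ∈ C := fun i => by
    refine Fin.addCases (fun j => ?_) (fun j => ?_) i
    · simpa using hPC (hpP j)
    · simpa using hy j
  obtain ⟨σ, hσ, hσC, -, hσxy⟩ := hW.exists_equiv_of_eqQFTypeOver_within hC (empty_subset C)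
    (Or.inr rfl) hmemx hmemy h0
  refine ⟨σ, hσ, hσC, fun q hq => ?_, fun i => ?_⟩
  · obtain ⟨j, rfl⟩ : q ∈ range p := hp ▸ hq
    have := hσxy (Fin.castAdd n j)
    simpa using this
  · have := hσxy (Fin.natAdd k i)
    simpa using this

/-- Same, over a finite set anywhere in `M` (the case `C = M`). [cite: BHHKK2014, Lemma 3.1] -/
theorem exists_equiv_of_eqQFTypeOver_finite' [Countable M]
    (hW : IsWeaklyQuasiminimalPregeometryStructure L M cl) {P : Set M} (hPfin : P.Finite)
    {n : ℕ} {x y : Fin n → M} (hxy : L.EqQFTypeOver P id x y) :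
    ∃ σ : M ≃ M, IsQFEmbOn L σ univ ∧ (∀ p ∈ P, σ p = p) ∧ ∀ i, σ (x i) = y i := by
  have huniv : cl (univ : Set M) = univ := eq_univ_of_univ_subset (hW.isPregeometry.subset_cl _)
  obtain ⟨σ, hσ, -, hσP, hσx⟩ := hW.exists_equiv_of_eqQFTypeOver_finite huniv hPfin
    (subset_univ P) (fun i => mem_univ (x i)) (fun i => mem_univ (y i)) hxy
  exact ⟨σ, hσ, hσP, hσx⟩

end IsWeaklyQuasiminimalPregeometryStructure

/-! ### Splitting (BHHKK 2014, Def. 4.1, Prop. 4.2) -/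

section Splitting

variable (L)

/-- **Non-splitting** (BHHKK 2014, Def. 4.1). `NotSplitOver L C a A`: the type of the tuple `ā`
over `C` does not split over `A` — whenever finite tuples `c̄, d̄` from `C` have the same type over
`A`, they have the same type over `A ∪ ā`. BHHKK state Def. 4.1 only for `A ⊆ B = C` finite; this
predicate omits both side conditions (they are carried by the conclusion `A.Finite ∧ A ⊆ C` of
Prop. 4.2, `exists_notSplitOver`), so it is Def. 4.1 verbatim only under them.
[cite: BHHKK2014, Def. 4.1] -/
def NotSplitOver (C : Set M) {n : ℕ} (a : Fin n → M) (A : Set M) : Prop :=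
  ∀ ⦃m : ℕ⦄ (c d : Fin m → M), (∀ i, c i ∈ C) → (∀ i, d i ∈ C) →
    L.EqQFTypeOver A id c d → L.EqQFTypeOver (A ∪ range a) id c d

variable {L}

/-- Non-splitting of `tp(ā/C)` over `C` itself is automatic (for any `C`, finite or not): tuples
from `C` with the same type over `C` are equal. [folklore] -/
theorem notSplitOver_self (C : Set M) {n : ℕ} (a : Fin n → M) : NotSplitOver L C a C := by
  intro m c d hc hd hcd
  have : c = d := by
    funext i
    have := (hcd ![c i] fun j => by simpa using hc i).append_eq (i := 0) (j := i) (by simp)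
    simpa using this
  subst this
  exact eqQFTypeOver_id_refl _ c

/-- The nodes of BHHKK's tree (proof of Prop. 4.2): a finite `A ⊆ C` and an automorphism `σ`
of `M` preserving `C` setwise. [cite: BHHKK2014, Prop. 4.2 (proof)] -/
structure SplitNode (L : Language.{u, v}) (M : Type w) [L.Structure M] (C : Set M) where
  /-- the finite set `A_η` -/
  A : Set M
  /-- `A_η` is finite -/
  finite : A.Finite
  /-- `A_η ⊆ C` -/
  subset : A ⊆ C
  /-- the automorphism `σ_η` -/
  σ : M ≃ M
  /-- `σ_η` is an automorphism -/
  isQFEmbOn : IsQFEmbOn L σ univ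
  /-- `σ_η(C) = C` -/
  image_eq : σ '' C = C

namespace IsWeaklyQuasiminimalPregeometryStructure

/-- **BHHKK 2014, Prop. 4.2: types over a countable closed set do not split over some finite
subset.** Let `M` be a countable weakly quasiminimal pregeometry structure, `C ⊆ M` closed and
`ā` a finite tuple. Then there is a finite `A ⊆ C` such that `tp(ā/C)` does not split over `A`.
Proof (BHHKK): otherwise build a binary tree of finite sets `A_η ⊆ C` and automorphisms `σ_η`
with `σ_η(C) = C`, using at each node tuples `c̄, d̄` witnessing splitting over `A_η`, an
automorphism `f` over `A_η` with `f(c̄) = d̄`, `f(C) = C` (Lemma 3.1), `σ_{η0} = σ_η`,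
`σ_{η1} = σ_η ∘ f`, and `A_{ηi} = A_η ∪ {e_k, σ_{ηi}⁻¹(e_k), c̄, d̄}`; along each branch `μ` the
`σ_{μ|k}` glue to an automorphism `f_μ` of `C`, which extends to `π_μ ∈ Aut(M)` (Lemma 3.1);
distinct branches give distinct `π_μ(ā)` — `2^ℵ₀` tuples in the countable `Mⁿ`.
[cite: BHHKK2014, Prop. 4.2] -/
theorem exists_notSplitOver [Countable M] (hW : IsWeaklyQuasiminimalPregeometryStructure L M cl)
    {C : Set M} (hC : cl C = C) {n : ℕ} (a : Fin n → M) :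
    ∃ A : Set M, A.Finite ∧ A ⊆ C ∧ NotSplitOver L C a A := by
  classical
  -- the finite case
  by_cases hCfin : C.Finite
  · exact ⟨C, hCfin, Subset.rfl, notSplitOver_self C a⟩
  by_contra hcon
  push Not at hcon
  -- splitting witnesses over every finite `A ⊆ C`, with the automorphism of Lemma 3.1
  have hsplit : ∀ A : Set M, A.Finite → A ⊆ C → ∃ (m : ℕ) (c d : Fin m → M) (f : M ≃ M),
      (∀ i, c i ∈ C) ∧ (∀ i, d i ∈ C) ∧ ¬ L.EqQFTypeOver (A ∪ range a) id c d ∧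
      IsQFEmbOn L f univ ∧ f '' C = C ∧ (∀ p ∈ A, f p = p) ∧ ∀ i, f (c i) = d i := by
    intro A hA hAC
    have := hcon A hA hAC
    simp only [NotSplitOver, not_forall, exists_prop] at this
    obtain ⟨m, c, d, hc, hd, hcd, hncd⟩ := this
    obtain ⟨f, hf, hfC, hfA, hfcd⟩ := hW.exists_equiv_of_eqQFTypeOver_finite hC hA hAC hc hd hcd
    exact ⟨m, c, d, f, hc, hd, hncd, hf, hfC, hfA, hfcd⟩
  -- enumerate `C`
  have hCne : C.Nonempty := Set.Infinite.nonempty hCfin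
  obtain ⟨e, he⟩ := (to_countable C).exists_eq_range hCne
  have heC : ∀ k, e k ∈ C := fun k => he ▸ mem_range_self k
  haveI : Nonempty M := ⟨e 0⟩
  choose! m c d f hc hd hncd hf hfC hfA hfcd using hsplit
  -- the step of the tree
  let child : SplitNode L M C → ℕ → Bool → SplitNode L M C := fun N k i =>
    let τ : M ≃ M := if i then (f N.A).trans N.σ else N.σ
    have hτ : IsQFEmbOn L τ univ := by
      by_cases hi : i
      · simp only [τ, if_pos hi]
        exact (hf N.A N.finite N.subset).comp (by
          rw [image_univ, (f N.A).surjective.range_eq]; exact N.isQFEmbOn)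
      · simp only [τ, if_neg hi]; exact N.isQFEmbOn
    have hτC : τ '' C = C := by
      by_cases hi : i
      · simp only [τ, if_pos hi, Equiv.coe_trans, image_comp]
        rw [hfC N.A N.finite N.subset, N.image_eq]
      · simp only [τ, if_neg hi]; exact N.image_eq
    { A := N.A ∪ ({e k, τ.symm (e k)} ∪ (range (c N.A) ∪ range (d N.A)))
      finite := N.finite.union (((finite_singleton _).insert _).union
        ((finite_range _).union (finite_range _)))
      subset := by
        refine union_subset N.subset (union_subset ?_ (union_subset ?_ ?_))
        · rintro x (rfl | rfl)
          · exact heC k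
          · have : τ.symm (e k) ∈ τ.symm '' C := mem_image_of_mem _ (heC k)
            rwa [Equiv.symm_image_eq_of_image_eq hτC] at this
        · exact range_subset_iff.2 (hc N.A N.finite N.subset)
        · exact range_subset_iff.2 (hd N.A N.finite N.subset)
      σ := τ
      isQFEmbOn := hτ
      image_eq := hτC }
  let root : SplitNode L M C :=
    { A := ∅
      finite := finite_empty
      subset := empty_subset C
      σ := Equiv.refl M
      isQFEmbOn := IsQFEmbOn.id univ
      image_eq := by simp }
  -- basic facts about `child`
  have hA_sub : ∀ N k i, N.A ⊆ (child N k i).A := fun N k i => subset_union_left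
  have hcd_sub : ∀ N k i, range (c N.A) ∪ range (d N.A) ⊆ (child N k i).A :=
    fun N k i => subset_union_right.trans (subset_union_right)
  have he_mem : ∀ N k i, e k ∈ (child N k i).A := fun N k i => Or.inr (Or.inl (Or.inl rfl))
  have he_pre : ∀ N k i, (child N k i).σ.symm (e k) ∈ (child N k i).A :=
    fun N k i => Or.inr (Or.inl (Or.inr rfl))
  have hσ_false : ∀ N k, (child N k false).σ = N.σ := fun N k => by
    simp [child]
  have hσ_true : ∀ N k, (child N k true).σ = (f N.A).trans N.σ := fun N k => by
    simp [child]
  have hσ_agree : ∀ N k i, ∀ p ∈ N.A, (child N k i).σ p = N.σ p := by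
    intro N k i p hp
    cases i
    · rw [hσ_false]
    · rw [hσ_true, Equiv.trans_apply, hfA N.A N.finite N.subset p hp]
  -- the key property of the two children: their images of `ā` have different types over
  -- `P = σ_η(A_η ∪ d̄)`, a set contained in both `σ_{ηi}(A_{ηi})`
  have hkey : ∀ N k, ¬ L.EqQFTypeOver (N.σ '' (N.A ∪ range (d N.A))) id
      ((child N k false).σ ∘ a) ((child N k true).σ ∘ a) := by
    intro N k hcontra
    rw [hσ_false, hσ_true] at hcontra
    set A := N.A with hAdef
    have hPfin : (N.σ '' (A ∪ range (d A))).Finite := (N.finite.union (finite_range _)).image _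
    obtain ⟨g, hg, hgP, hga⟩ := hW.exists_equiv_of_eqQFTypeOver_finite' hPfin hcontra
    -- `h = f⁻¹ σ⁻¹ g σ` fixes `A ∪ ā` and maps `d̄ ↦ c̄`
    let h : M ≃ M := ((N.σ.trans g).trans N.σ.symm).trans (f A).symm
    have hh : IsQFEmbOn L h univ := by
      have h1 : IsQFEmbOn L (N.σ.trans g) univ := N.isQFEmbOn.comp (by
        rw [image_univ, N.σ.surjective.range_eq]; exact hg)
      have h2 : IsQFEmbOn L ((N.σ.trans g).trans N.σ.symm) univ := h1.comp (by
        rw [image_univ, (N.σ.trans g).surjective.range_eq]; exact isQFEmbOn_symm N.isQFEmbOn)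
      exact h2.comp (by
        rw [image_univ, ((N.σ.trans g).trans N.σ.symm).surjective.range_eq]
        exact isQFEmbOn_symm (hf A N.finite N.subset))
    have hhA : ∀ p ∈ A ∪ range a, h p = p := by
      rintro p (hp | ⟨i, rfl⟩)
      · change (f A).symm (N.σ.symm (g (N.σ p))) = p
        rw [hgP _ ⟨p, Or.inl hp, rfl⟩, Equiv.symm_apply_apply, Equiv.symm_apply_eq]
        exact (hfA A N.finite N.subset p hp).symm
      · change (f A).symm (N.σ.symm (g (N.σ (a i)))) = a i
        have := hga i
        simp only [Function.comp_apply, Equiv.trans_apply] at this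
        rw [this, Equiv.symm_apply_apply, Equiv.symm_apply_apply]
    have hhd : ∀ j, h (d A j) = c A j := by
      intro j
      change (f A).symm (N.σ.symm (g (N.σ (d A j)))) = c A j
      rw [hgP _ ⟨d A j, Or.inr (mem_range_self j), rfl⟩, Equiv.symm_apply_apply,
        Equiv.symm_apply_eq]
      exact (hfcd A N.finite N.subset j).symm
    have := eqQFTypeOver_id_of_isQFEmbOn hh hhA (d A)
    have e1 : (h : M → M) ∘ d A = c A := funext hhd
    rw [e1] at this
    exact hncd A N.finite N.subset (eqQFTypeOver_id_symm this)
  have hP_sub : ∀ N k i, N.σ '' (N.A ∪ range (d N.A)) ⊆ (child N k i).σ '' (child N k i).A := by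
    intro N k i
    cases i
    · rw [hσ_false]
      exact image_mono (union_subset (hA_sub N k false)
        (subset_union_right.trans (hcd_sub N k false)))
    · rw [hσ_true]
      rintro _ ⟨p, hp, rfl⟩
      rcases hp with hp | ⟨j, rfl⟩
      · exact ⟨p, hA_sub N k true hp, by
          rw [Equiv.trans_apply, hfA N.A N.finite N.subset p hp]⟩
      · exact ⟨c N.A j, hcd_sub N k true (Or.inl (mem_range_self j)), by
          rw [Equiv.trans_apply, hfcd N.A N.finite N.subset j]⟩
  -- the tree
  let node : (k : ℕ) → (Fin k → Bool) → SplitNode L M C := fun k =>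
    Nat.rec (motive := fun k => (Fin k → Bool) → SplitNode L M C) (fun _ => root)
      (fun k ih η => child (ih (Fin.init η)) k (η (Fin.last k))) k
  have hnode_succ : ∀ k (η : Fin (k + 1) → Bool),
      node (k + 1) η = child (node k (Fin.init η)) k (η (Fin.last k)) := fun k η => rfl
  -- branches
  let pre : (ℕ → Bool) → (k : ℕ) → (Fin k → Bool) := fun μ k i => μ i
  have hpre_init : ∀ μ k, Fin.init (pre μ (k + 1)) = pre μ k := fun μ k => by
    funext i; simp [pre, Fin.init]
  have hpre_last : ∀ μ k, pre μ (k + 1) (Fin.last k) = μ k := fun μ k => by simp [pre]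
  let br : (ℕ → Bool) → ℕ → SplitNode L M C := fun μ k => node k (pre μ k)
  have hbr_succ : ∀ μ k, br μ (k + 1) = child (br μ k) k (μ k) := by
    intro μ k
    change node (k + 1) (pre μ (k + 1)) = _
    rw [hnode_succ, hpre_init, hpre_last]
  have hbrA_mono : ∀ μ, Monotone fun k => (br μ k).A := by
    intro μ
    refine monotone_nat_of_le_succ fun k => ?_
    rw [hbr_succ]
    exact hA_sub _ _ _
  have hbr_agree : ∀ μ {k k'}, k ≤ k' → ∀ p ∈ (br μ k).A, (br μ k').σ p = (br μ k).σ p := by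
    intro μ k k' hkk'
    induction hkk' with
    | refl => exact fun p _ => rfl
    | step hle ih =>
      intro p hp
      rw [hbr_succ, hσ_agree _ _ _ p (hbrA_mono μ hle hp), ih p hp]
  have hbrA_cover : ∀ μ, (⋃ k, (br μ k).A) = C := by
    intro μ
    refine Subset.antisymm (iUnion_subset fun k => (br μ k).subset) ?_
    intro x hx
    obtain ⟨k, rfl⟩ : x ∈ range e := he ▸ hx
    refine mem_iUnion.2 ⟨k + 1, ?_⟩
    rw [hbr_succ]
    exact he_mem _ _ _
  -- glue the automorphisms along a branch
  have hglue : ∀ μ, ∃ π : M ≃ M, IsQFEmbOn L π univ ∧ ∀ k, ∀ p ∈ (br μ k).A, π p = (br μ k).σ p := by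
    intro μ
    let F : M → M := fun x => if hx : ∃ k, x ∈ (br μ k).A then (br μ (Nat.find hx)).σ x else x
    have hF : ∀ k, ∀ p ∈ (br μ k).A, F p = (br μ k).σ p := by
      intro k p hp
      have hex : ∃ k, p ∈ (br μ k).A := ⟨k, hp⟩
      simp only [F, dif_pos hex]
      exact (hbr_agree μ (Nat.find_min' hex hp) p (Nat.find_spec hex)).symm
    have hFC : IsQFEmbOn L F C := by
      rw [← hbrA_cover μ]
      exact IsQFEmbOn.iUnion_nat (hbrA_mono μ) fun k =>
        ((br μ k).isQFEmbOn.mono (subset_univ _)).congr fun p hp => (hF k p hp).symm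
    have hFim : F '' C = C := by
      refine Subset.antisymm ?_ ?_
      · rintro _ ⟨p, hp, rfl⟩
        rw [← hbrA_cover μ] at hp
        obtain ⟨k, hk⟩ := mem_iUnion.1 hp
        rw [hF k p hk]
        have := mem_image_of_mem (br μ k).σ ((br μ k).subset hk)
        rwa [(br μ k).image_eq] at this
      · intro x hx
        obtain ⟨k, rfl⟩ : x ∈ range e := he ▸ hx
        refine ⟨(br μ (k + 1)).σ.symm (e k), ?_, ?_⟩
        · exact (br μ (k + 1)).subset (by rw [hbr_succ]; exact he_pre _ _ _)
        · rw [hF (k + 1) _ (by rw [hbr_succ]; exact he_pre _ _ _), Equiv.apply_symm_apply]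
    obtain ⟨π, hπ, hπF⟩ := hW.exists_equiv_extend hC hFC hFim
    exact ⟨π, hπ, fun k p hp => (hπF p ((br μ k).subset hp)).trans (hF k p hp)⟩
  choose π hπ hπσ using hglue
  -- distinct branches give distinct images of `ā`
  have hinj : Function.Injective fun μ => (π μ : M → M) ∘ a := by
    intro μ ν hμν
    by_contra hne
    have hex : ∃ k, μ k ≠ ν k := by
      by_contra hall
      push Not at hall
      exact hne (funext hall)
    let k := Nat.find hex
    have hk : μ k ≠ ν k := Nat.find_spec hex
    have hlt : ∀ i < k, μ i = ν i := fun i hi => by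
      have := Nat.find_min hex hi
      simpa using this
    have hpre : pre μ k = pre ν k := funext fun i => hlt i i.isLt
    set N := br μ k with hN
    have hN' : br ν k = N := by change node k (pre ν k) = node k (pre μ k); rw [hpre]
    -- types of `π_μ ā`, `π_ν ā` over `σ_{k+1}(A_{k+1})`
    have htp : ∀ ρ : ℕ → Bool, L.EqQFTypeOver ((br ρ (k + 1)).σ '' (br ρ (k + 1)).A) id
        ((br ρ (k + 1)).σ ∘ a) ((π ρ : M → M) ∘ a) := by
      intro ρ
      set N₁ := br ρ (k + 1)
      let θ : M ≃ M := N₁.σ.symm.trans (π ρ)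
      have hθ : IsQFEmbOn L θ univ := (isQFEmbOn_symm N₁.isQFEmbOn).comp (by
        rw [image_univ, N₁.σ.symm.surjective.range_eq]; exact hπ ρ)
      have hθP : ∀ p ∈ N₁.σ '' N₁.A, θ p = p := by
        rintro _ ⟨q, hq, rfl⟩
        change π ρ (N₁.σ.symm (N₁.σ q)) = N₁.σ q
        rw [Equiv.symm_apply_apply, hπσ ρ (k + 1) q hq]
      have := eqQFTypeOver_id_of_isQFEmbOn hθ hθP (N₁.σ ∘ a)
      have e1 : (θ : M → M) ∘ (N₁.σ ∘ a) = (π ρ : M → M) ∘ a := by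
        funext i
        change π ρ (N₁.σ.symm (N₁.σ (a i))) = π ρ (a i)
        rw [Equiv.symm_apply_apply]
      rwa [e1] at this
    have hμk := htp μ
    have hνk := htp ν
    rw [hbr_succ] at hμk hνk
    rw [hN'] at hνk
    change L.EqQFTypeOver _ id ((child N k (μ k)).σ ∘ a) _ at hμk
    have hPμ := eqQFTypeOver_id_mono (hP_sub N k (μ k)) hμk
    have hPν := eqQFTypeOver_id_mono (hP_sub N k (ν k)) hνk
    have hμν' : ((π μ : M → M) ∘ a) = ((π ν : M → M) ∘ a) := hμν
    rw [hμν'] at hPμ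
    -- `tp(σ_{k, μ k} ā / P) = tp(σ_{k, ν k} ā / P)`
    have hboth := eqQFTypeOver_id_trans hPμ (eqQFTypeOver_id_symm hPν)
    rcases Bool.eq_false_or_eq_true (μ k) with hμt | hμf
    · have hνf : ν k = false := by
        rcases Bool.eq_false_or_eq_true (ν k) with h | h
        · exact absurd (hμt.trans h.symm) hk
        · exact h
      rw [hμt, hνf] at hboth
      exact hkey N k (eqQFTypeOver_id_symm hboth)
    · have hνt : ν k = true := by
        rcases Bool.eq_false_or_eq_true (ν k) with h | h
        · exact h
        · exact absurd (hμf.trans h.symm) hk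
      rw [hμf, hνt] at hboth
      exact hkey N k hboth
  -- `2^ℕ` does not inject into the countable `Mⁿ`
  obtain ⟨ι, hι⟩ := exists_injective_nat (Fin n → M)
  let Φ : Set ℕ → ℕ := fun S => ι ((π fun i => decide (i ∈ S) : M → M) ∘ a)
  refine Function.cantor_injective Φ fun S T hST => ?_
  have h1 := hinj (hι hST)
  ext i
  have := congr_fun h1 i
  simpa using this

end IsWeaklyQuasiminimalPregeometryStructure

end Splitting

end Literature.ModelTheory.Quasiminimal

end
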